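import Summits.BirchSwinnertonDyer.BirchSwinnertonDyer.Theorems.EdixhovenFibreFiveSevenStarredOptimalManinUnitFiveSevenHcorTransfer
import Literature.NumberTheory.Automorphic.UnboundedDenominatorsInvariantHomPrimeSquare
import HarnessLib

set_option autoImplicit false
-- the sub-problem namespace `Summit.BirchSwinnertonDyer.BirchSwinnertonDyer` duplicates a component by design (D-0017)
set_option linter.dupNamespace false

/-!
# K★ line `cdt_thm1`, stub `stub_hcor_invariant`: levels with `p² ∥ N` (`p` odd)

Crux `StarredOptimalManinUnitFiveSeven` (stmt-BirchSwinnertonDyer-22226); skeleton v17 has the single stub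
`stub_hcor_invariant` (all `N`).  With the `p²`-block certificate
(`UnboundedDenominatorsInvariantHomPrimeSquare.local_Gamma_prime_sq`: the Schur multiplier of `SL₂(ℤ/p²)` has
no `p`-part for odd `p`), the transfer step and the gluing framework, this file proves:

* `cor453_invariant_form_of_cube_not_dvd_exponent` — `ℓ` odd, `Q` of exponent `ℓ^a`, `ℓ³ ∤ N`: every
  `SL₂(ℤ)`-invariant `θ : Γ(N) → Q` is trivial on `Γ(12N)`;
* `cor453_invariant_form_of_cube_not_dvd` — every finite commutative `Q`, provided each prime `ℓ ∣ |Q|` has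
  `ℓ³ ∤ N`, and `4 ∤ N` if `ℓ = 2`;
* `cor453_invariant_form_cubefree` — **for every cube-free `N` with `4 ∤ N` and every finite commutative `Q`,
  every `SL₂(ℤ)`-invariant `θ : Γ(N) → Q` kills `Γ(12N)`**; `stub_hcor_invariant_cubefree` (the stub's exact
  shape for such `N`); `Gamma_mul_le_commutator_of_cubefree : Γ(12N) ≤ [SL₂(ℤ), Γ(N)]`;
* `exists_pow_mem_commutator_of_cube_not_dvd` — for odd `ℓ` with `ℓ³ ∤ N` the `ℓ`-part of
  `Γ(12N)/(Γ(12N) ∩ [SL₂(ℤ), Γ(N)])` vanishes.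

What is left of the stub: odd `p` with `p³ ∣ N` (Schur multiplier of `SL₂(ℤ/p^e)`, `e ≥ 3`) and `4 ∣ N`
(the genuine `ℤ/2`, [Beyl1986]).  K★ / Manin / BSD are not proved.
-/

open scoped MatrixGroups commutatorElement

namespace Summit.BirchSwinnertonDyer.BirchSwinnertonDyer.Theorems

namespace HcorPrimeSquare

open CongruenceSubgroup Matrix.SpecialLinearGroup ModularGroup
open Literature.NumberTheory.Automorphic.UnboundedDenominators

/-- `Γ(L) ≤ Γ(M)` for `M ∣ L`. [folklore] -/
private theorem Gamma_le_Gamma_of_dvd₈ {M L : ℕ} (h : M ∣ L) : Gamma L ≤ Gamma M := by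
  intro γ hγ
  obtain ⟨h00, h01, h10, h11⟩ := Gamma_mem.mp hγ
  have cast_eq : ∀ a : ℤ, ((a : ZMod L).cast : ZMod M) = (a : ZMod M) := fun a ↦
    ZMod.cast_intCast h a
  rw [Gamma_mem]
  refine ⟨?_, ?_, ?_, ?_⟩
  · rw [← cast_eq, h00, ZMod.cast_one h]
  · rw [← cast_eq, h01, ZMod.cast_zero]
  · rw [← cast_eq, h10, ZMod.cast_zero]
  · rw [← cast_eq, h11, ZMod.cast_one h]

/-- The `p²`-block certificate with the level as a variable. [cite: CalegariDimitrovTang2025, Corollary 4.5.3] -/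
private theorem local_Gamma_prime_sq' {Q : Type*} [CommGroup Q] {N p m' a : ℕ} (hN : N = m' * p ^ 2)
    (hp : p.Prime) (hp2 : p ≠ 2) [NeZero m'] (hmm : m'.Coprime p) (θ : Gamma N →* Q)
    (hθ : ∀ (g x : SL(2, ℤ)) (hx : x ∈ Gamma N) (hgx : g * x * g⁻¹ ∈ Gamma N),
      θ ⟨g * x * g⁻¹, hgx⟩ = θ ⟨x, hx⟩)
    (he : ∀ x : Gamma N, θ x ^ (p ^ a) = 1) :
    ∀ (y : SL(2, ℤ)) (hy : y ∈ Gamma N),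
      y ∈ ⁅Gamma m', Gamma m'⁆ ⊔ θ.ker.map (Gamma N).subtype → θ ⟨y, hy⟩ = 1 := by
  subst hN
  exact local_Gamma_prime_sq hp hp2 hmm θ hθ he

/-- The transfer step with the level as a variable. [cite: CalegariDimitrovTang2025, Corollary 4.5.3] -/
private theorem transfer_step'' {Q : Type*} [CommGroup Q] {N M p e M₀ : ℕ} [NeZero M] (hN : N = M * p)
    (hp : p.Prime) (hpM : p ∣ M) (hcop : e.Coprime p) (hQ : ∀ q : Q, q ^ e = 1)
    (hM : ∀ ψ : Gamma M →* Q,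
      (∀ (g x : SL(2, ℤ)) (hx : x ∈ Gamma M) (hgx : g * x * g⁻¹ ∈ Gamma M),
        ψ ⟨g * x * g⁻¹, hgx⟩ = ψ ⟨x, hx⟩) →
      ∀ (x : SL(2, ℤ)) (hx : x ∈ Gamma M), x ∈ Gamma M₀ → ψ ⟨x, hx⟩ = 1)
    (θ : Gamma N →* Q)
    (hθ : ∀ (g x : SL(2, ℤ)) (hx : x ∈ Gamma N) (hgx : g * x * g⁻¹ ∈ Gamma N),
      θ ⟨g * x * g⁻¹, hgx⟩ = θ ⟨x, hx⟩) :
    ∀ (x : SL(2, ℤ)) (hx : x ∈ Gamma N), x ∈ Gamma M₀ → θ ⟨x, hx⟩ = 1 := by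
  subst hN
  exact map_eq_one_of_transfer_step hp hpM hcop hQ hM θ hθ

/-- **Block induction at a level `N = m · ℓ²`, `m` squarefree and prime to the odd prime `ℓ`**: for `θ` of
`ℓ`-power exponent, the local condition holds for `Γ(c)` for every `c ∣ m` (glue the `ℓ²`-block certificate
for `Γ(m)` with the cyclic/dicyclic certificates at the primes of `m`). [cite: CalegariDimitrovTang2025, Corollary 4.5.3] -/
theorem local_Gamma_of_squarefree_mul_sq {Q : Type*} [CommGroup Q] {N m ℓ a : ℕ} (hℓ : ℓ.Prime) (hℓ2 : ℓ ≠ 2)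
    (hN : N = m * ℓ ^ 2) (hm : Squarefree m) (hmℓ : m.Coprime ℓ) (θ : Gamma N →* Q)
    (hθ : ∀ (g x : SL(2, ℤ)) (hx : x ∈ Gamma N) (hgx : g * x * g⁻¹ ∈ Gamma N),
      θ ⟨g * x * g⁻¹, hgx⟩ = θ ⟨x, hx⟩)
    (he : ∀ x : Gamma N, θ x ^ (ℓ ^ a) = 1) :
    ∀ (d c : ℕ), m = d * c → ∀ (y : SL(2, ℤ)) (hy : y ∈ Gamma N),
      y ∈ ⁅Gamma c, Gamma c⁆ ⊔ θ.ker.map (Gamma N).subtype → θ ⟨y, hy⟩ = 1 := by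
  intro d
  induction d using Nat.strong_induction_on with
  | _ d ih =>
  intro c hdc
  have hm0 : m ≠ 0 := Squarefree.ne_zero hm
  rcases Nat.lt_or_ge 1 d with hd1 | hd1
  swap
  · -- `d = 1`, `c = m`: the `ℓ²`-block certificate
    have hd : d = 1 := by
      rcases Nat.le_one_iff_eq_zero_or_eq_one.mp hd1 with h | h
      · exfalso; rw [h, zero_mul] at hdc; exact hm0 hdc
      · exact h
    rw [hd, one_mul] at hdc
    subst hdc
    haveI : NeZero m := ⟨hm0⟩
    exact local_Gamma_prime_sq' hN hℓ hℓ2 hmℓ θ hθ he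
  · -- `d = p · d'`
    obtain ⟨p, hp, hpd⟩ := Nat.exists_prime_and_dvd (show d ≠ 1 by omega)
    obtain ⟨d', rfl⟩ := hpd
    have hd'lt : d' < p * d' := by
      have hd'0 : 0 < d' := Nat.pos_of_ne_zero (by rintro rfl; simp at hd1)
      exact lt_mul_of_one_lt_left hd'0 hp.one_lt
    have hm' : m = c * p * d' := by rw [hdc]; ring
    have hsq : Squarefree (c * p * d') := hm' ▸ hm
    have hN' : N = c * p * (d' * ℓ ^ 2) := by rw [hN, hm']; ring
    -- coprimality of `c p` and `d' ℓ²`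
    have hcop1 : (c * p).Coprime d' := Nat.coprime_of_squarefree_mul hsq
    have hcop2 : (c * p).Coprime ℓ := Nat.Coprime.coprime_dvd_left ⟨d', hm'⟩ hmℓ
    have hcop : (c * p).Coprime (d' * ℓ ^ 2) := Nat.Coprime.mul_right hcop1 (Nat.Coprime.pow_right 2 hcop2)
    -- induction hypothesis: the local condition for `Γ(c p)`
    have ih₁ := ih d' hd'lt (c * p) (by rw [hm']; ring)
    -- local certificate at `p`: the local condition for `Γ(c d' ℓ²)`
    have hN0 : N ≠ 0 := by rw [hN]; exact Nat.mul_ne_zero hm0 (pow_ne_zero 2 hℓ.ne_zero)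
    haveI : NeZero (c * (d' * ℓ ^ 2)) := ⟨by
      intro h0; apply hN0; rw [hN']
      rcases mul_eq_zero.mp h0 with h | h
      · simp [h]
      · rw [h, mul_zero]⟩
    have hcop' : (c * (d' * ℓ ^ 2)).Coprime p := by
      have h1 : Squarefree (c * d' * p) := by rw [show c * d' * p = c * p * d' by ring]; exact hsq
      have h2 : (c * d').Coprime p := Nat.coprime_of_squarefree_mul h1
      have h3 : ℓ.Coprime p := by
        have : p.Coprime ℓ := Nat.Coprime.coprime_dvd_left ⟨c * d', by rw [hm']; ring⟩ hmℓ
        exact this.symm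
      rw [show c * (d' * ℓ ^ 2) = c * d' * ℓ ^ 2 by ring]
      exact Nat.Coprime.mul_left h2 (Nat.Coprime.pow_left 2 h3)
    have ih₂ := HcorSquarefree.local_Gamma_prime' (N := N) (m' := c * (d' * ℓ ^ 2)) (by rw [hN']; ring) hp hℓ
      hcop' θ hθ he
    exact local_Gamma_of_local_Gamma_mul' hN' hcop θ hθ ih₁ ih₂

/-- **Odd `ℓ`, targets of exponent `ℓ^a`, `ℓ³ ∤ N`.**  Every `SL₂(ℤ)`-conjugation-invariant `θ : Γ(N) → Q` is
trivial on `Γ(12N)`. [cite: CalegariDimitrovTang2025, Corollary 4.5.3] [cite: Beyl1986, Theorem] -/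
theorem cor453_invariant_form_of_cube_not_dvd_exponent {ℓ a : ℕ} (hℓ : ℓ.Prime) (hℓ2 : ℓ ≠ 2) :
    ∀ {N : ℕ}, N ≠ 0 → ¬ ℓ ^ 3 ∣ N → ∀ (Q : Type*) [CommGroup Q] [Finite Q],
      (∀ q : Q, q ^ (ℓ ^ a) = 1) → ∀ (θ : Gamma N →* Q),
      (∀ (g x : SL(2, ℤ)) (hx : x ∈ Gamma N) (hgx : g * x * g⁻¹ ∈ Gamma N),
        θ ⟨g * x * g⁻¹, hgx⟩ = θ ⟨x, hx⟩) →
      ∀ (x : SL(2, ℤ)) (hx : x ∈ Gamma N), x ∈ Gamma (12 * N) → θ ⟨x, hx⟩ = 1 := by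
  intro N
  induction N using Nat.strong_induction_on with
  | _ N ih =>
  intro hN0 hℓN Q _ _ hQ θ hθ x hx hx12
  by_cases hA : ∃ p : ℕ, p.Prime ∧ p ≠ ℓ ∧ p * p ∣ N
  · -- strip a prime `p ≠ ℓ` from the square part by the transfer step
    obtain ⟨p, hp, hpℓ, c, hc⟩ := hA
    have hc0 : c ≠ 0 := by rintro rfl; exact hN0 (by rw [hc, mul_zero])
    haveI : NeZero (p * c) := ⟨Nat.mul_ne_zero hp.ne_zero hc0⟩
    have hNM : N = p * c * p := by rw [hc]; ring
    have hMlt : p * c < N := by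
      rw [hNM]
      exact lt_mul_of_one_lt_right (Nat.pos_of_ne_zero (NeZero.ne (p * c))) hp.one_lt
    have hℓM : ¬ ℓ ^ 3 ∣ p * c := fun h ↦ hℓN (h.trans ⟨p, hNM⟩)
    have hcop : (ℓ ^ a).Coprime p := Nat.Coprime.pow_left a ((Nat.coprime_primes hℓ hp).mpr hpℓ.symm)
    have hM := fun (ψ : Gamma (p * c) →* Q) hψ ↦ ih (p * c) hMlt (NeZero.ne _) hℓM Q hQ ψ hψ
    refine transfer_step'' (M₀ := 12 * (p * c)) hNM hp (dvd_mul_right p c) hcop hQ hM θ hθ x hx ?_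
    exact Gamma_le_Gamma_of_dvd₈ (mul_dvd_mul_left 12 ⟨p, hNM⟩) hx12
  · push Not at hA
    by_cases hsqN : Squarefree N
    · exact HcorSquarefree.cor453_invariant_form_squarefree hsqN Q θ hθ x hx hx12
    · -- `N = m ℓ²` with `m` squarefree and prime to `ℓ`
      rw [Nat.squarefree_iff_prime_squarefree] at hsqN
      push Not at hsqN
      obtain ⟨q, hq, hqN⟩ := hsqN
      have hqℓ : q = ℓ := by
        by_contra h
        exact hA q hq h hqN
      subst hqℓ
      obtain ⟨m, hm⟩ := hqN
      have hNm : N = m * q ^ 2 := by rw [hm]; ring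
      have hmℓ : m.Coprime q := by
        rw [Nat.Coprime, Nat.gcd_comm, ← Nat.Coprime, Nat.Prime.coprime_iff_not_dvd hq]
        rintro ⟨c, rfl⟩
        exact hℓN ⟨c, by rw [hm]; ring⟩
      have hmsq : Squarefree m := by
        rw [Nat.squarefree_iff_prime_squarefree]
        intro p hp hpm
        by_cases hpq : p = q
        · subst hpq
          exact (Nat.Prime.coprime_iff_not_dvd hp).mp hmℓ.symm (dvd_trans (dvd_mul_right p p) hpm)
        · exact hA p hp hpq (hpm.trans ⟨q ^ 2, hNm⟩)
      have he : ∀ y : Gamma N, θ y ^ (q ^ a) = 1 := fun y ↦ hQ _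
      have hloc := local_Gamma_of_squarefree_mul_sq hq hℓ2 hNm hmsq hmℓ θ hθ he m 1 (mul_one m).symm
      refine hloc x hx ?_
      rw [Gamma_one_top]
      exact Subgroup.mem_sup_left
        (Subgroup.mem_inf.mp (Literature.NumberTheory.ModularForms.SL2Z.Gamma_mul_le_inf_commutator N hx12)).2

/-- The `ℓ`-primary part for an arbitrary finite target, `ℓ` odd with `ℓ³ ∤ N`.
[cite: CalegariDimitrovTang2025, Corollary 4.5.3] -/
theorem pow_ordCompl_eq_one_of_cube_not_dvd {ℓ N : ℕ} (hℓ : ℓ.Prime) (hℓ2 : ℓ ≠ 2) (hN0 : N ≠ 0)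
    (hℓN : ¬ ℓ ^ 3 ∣ N) (Q : Type*) [CommGroup Q] [Finite Q] (θ : Gamma N →* Q)
    (hθ : ∀ (g x : SL(2, ℤ)) (hx : x ∈ Gamma N) (hgx : g * x * g⁻¹ ∈ Gamma N),
      θ ⟨g * x * g⁻¹, hgx⟩ = θ ⟨x, hx⟩) :
    ∀ (x : SL(2, ℤ)) (hx : x ∈ Gamma N), x ∈ Gamma (12 * N) →
      θ ⟨x, hx⟩ ^ (ordCompl[ℓ] (Nat.card Q)) = 1 := by
  intro x hx hx12
  set n : ℕ := Nat.card Q with hn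
  set m : ℕ := ordCompl[ℓ] n with hm_def
  have hnm : ordProj[ℓ] n * m = n := Nat.ordProj_mul_ordCompl_eq_self n ℓ
  have hpow : ∀ (y : Gamma N), ((powMonoidHom m).comp θ) y = θ y ^ m := fun y ↦ rfl
  have he : ∀ y : Gamma N, ((powMonoidHom m).comp θ) y ^ (ℓ ^ n.factorization ℓ) = 1 := by
    intro y
    rw [hpow, ← pow_mul, mul_comm, hnm, hn]
    exact pow_card_eq_one'
  set T : Subgroup Q := (powMonoidHom (ℓ ^ n.factorization ℓ) : Q →* Q).ker with hT
  set θT : Gamma N →* T := ((powMonoidHom m).comp θ).codRestrict T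
    (fun y ↦ by rw [hT, MonoidHom.mem_ker, powMonoidHom_apply]; exact he y) with hθT
  have hθTval : ∀ y : Gamma N, ((θT y : T) : Q) = θ y ^ m := fun y ↦ rfl
  have hQT : ∀ q : T, q ^ (ℓ ^ n.factorization ℓ) = 1 := by
    intro q
    apply Subtype.ext
    have hq : (q : Q) ∈ (powMonoidHom (ℓ ^ n.factorization ℓ) : Q →* Q).ker := q.2
    rw [MonoidHom.mem_ker, powMonoidHom_apply] at hq
    rw [Subgroup.coe_pow, Subgroup.coe_one]
    exact hq
  have hθTinv : ∀ (g y : SL(2, ℤ)) (hy : y ∈ Gamma N) (hgy : g * y * g⁻¹ ∈ Gamma N),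
      θT ⟨g * y * g⁻¹, hgy⟩ = θT ⟨y, hy⟩ := by
    intro g y hy hgy
    apply Subtype.ext
    rw [hθTval, hθTval, hθ g y hy hgy]
  have h1 := cor453_invariant_form_of_cube_not_dvd_exponent hℓ hℓ2 hN0 hℓN T hQT θT hθTinv x hx hx12
  have h2 := congrArg Subtype.val h1
  rw [hθTval, Subgroup.coe_one] at h2
  exact h2

/-- **The invariant form of CDT Cor. 4.5.3 whenever each prime `ℓ ∣ |Q|` has `ℓ³ ∤ N` (and `4 ∤ N` if
`ℓ = 2`).** [cite: CalegariDimitrovTang2025, Corollary 4.5.3] [cite: Beyl1986, Theorem] -/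
theorem cor453_invariant_form_of_cube_not_dvd {N : ℕ} (hN0 : N ≠ 0) (Q : Type*) [CommGroup Q] [Finite Q]
    (hQN : ∀ ℓ : ℕ, ℓ.Prime → ℓ ∣ Nat.card Q → ¬ ℓ ^ 3 ∣ N ∧ (ℓ = 2 → ¬ 4 ∣ N)) (θ : Gamma N →* Q)
    (hθ : ∀ (g x : SL(2, ℤ)) (hx : x ∈ Gamma N) (hgx : g * x * g⁻¹ ∈ Gamma N),
      θ ⟨g * x * g⁻¹, hgx⟩ = θ ⟨x, hx⟩) :
    ∀ (x : SL(2, ℤ)) (hx : x ∈ Gamma N), x ∈ Gamma (12 * N) → θ ⟨x, hx⟩ = 1 := by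
  intro x hx hx12
  set n : ℕ := Nat.card Q with hn
  have hn0 : n ≠ 0 := Nat.card_pos.ne'
  by_contra hne
  have hord : orderOf (θ ⟨x, hx⟩) ≠ 1 := fun h1 ↦ hne (orderOf_eq_one_iff.mp h1)
  obtain ⟨ℓ, hℓ, hℓq⟩ := Nat.exists_prime_and_dvd hord
  have hℓn : ℓ ∣ n := hℓq.trans (orderOf_dvd_of_pow_eq_one (hn ▸ pow_card_eq_one'))
  have key : θ ⟨x, hx⟩ ^ (ordCompl[ℓ] n) = 1 := by
    by_cases hℓ2 : ℓ = 2
    · have h4 : ¬ ℓ ^ 2 ∣ N := by rw [hℓ2]; exact (hQN ℓ hℓ hℓn).2 hℓ2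
      exact HcorTransfer.pow_ordCompl_eq_one_of_sq_not_dvd hℓ hN0 h4 Q θ hθ x hx hx12
    · exact pow_ordCompl_eq_one_of_cube_not_dvd hℓ hℓ2 hN0 (hQN ℓ hℓ hℓn).1 Q θ hθ x hx hx12
  have h1 : ℓ ∣ ordCompl[ℓ] n := hℓq.trans (orderOf_dvd_of_pow_eq_one key)
  exact hℓ.one_lt.ne' (Nat.Coprime.eq_one_of_dvd (Nat.coprime_ordCompl hℓ hn0) h1)

/-- **Cube-free levels not divisible by `4`: the invariant form of CDT Cor. 4.5.3 in full**, for every finite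
commutative target. [cite: CalegariDimitrovTang2025, Corollary 4.5.3] [cite: Beyl1986, Theorem] -/
theorem cor453_invariant_form_cubefree {N : ℕ} (hN0 : N ≠ 0) (hcf : ∀ p : ℕ, p.Prime → ¬ p ^ 3 ∣ N)
    (h4 : ¬ 4 ∣ N) (Q : Type*) [CommGroup Q] [Finite Q] (θ : Gamma N →* Q)
    (hθ : ∀ (g x : SL(2, ℤ)) (hx : x ∈ Gamma N) (hgx : g * x * g⁻¹ ∈ Gamma N),
      θ ⟨g * x * g⁻¹, hgx⟩ = θ ⟨x, hx⟩) :
    ∀ (x : SL(2, ℤ)) (hx : x ∈ Gamma N), x ∈ Gamma (12 * N) → θ ⟨x, hx⟩ = 1 :=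
  cor453_invariant_form_of_cube_not_dvd hN0 Q (fun ℓ hℓ _ ↦ ⟨hcf ℓ hℓ, fun _ ↦ h4⟩) θ hθ

/-- In the exact shape of `stub_hcor_invariant`, for cube-free `N` with `4 ∤ N`: `M = 12N`.
K★ / Manin / BSD are NOT proved by this. [cite: CalegariDimitrovTang2025, Corollary 4.5.3] -/
theorem stub_hcor_invariant_cubefree {N : ℕ} (hN0 : N ≠ 0) (hcf : ∀ p : ℕ, p.Prime → ¬ p ^ 3 ∣ N)
    (h4 : ¬ 4 ∣ N) (Q : Type) [CommGroup Q] [Finite Q] (θ : Gamma N →* Q)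
    (hθ : ∀ (g x : SL(2, ℤ)) (hx : x ∈ Gamma N) (hgx : g * x * g⁻¹ ∈ Gamma N),
      θ ⟨g * x * g⁻¹, hgx⟩ = θ ⟨x, hx⟩) :
    ∃ M : ℕ, M ≠ 0 ∧ ∀ (x : SL(2, ℤ)) (hx : x ∈ Gamma N), x ∈ Gamma M → θ ⟨x, hx⟩ = 1 :=
  ⟨12 * N, Nat.mul_ne_zero (by norm_num) hN0, cor453_invariant_form_cubefree hN0 hcf h4 Q θ hθ⟩

/-- **`Γ(12N) ≤ [SL₂(ℤ), Γ(N)]` for every cube-free `N` with `4 ∤ N`.** [cite: Beyl1986, Theorem]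
[cite: CalegariDimitrovTang2025, Corollary 4.5.3] -/
theorem Gamma_mul_le_commutator_of_cubefree {N : ℕ} (hN0 : N ≠ 0) (hcf : ∀ p : ℕ, p.Prime → ¬ p ^ 3 ∣ N)
    (h4 : ¬ 4 ∣ N) : Gamma (12 * N) ≤ ⁅(⊤ : Subgroup SL(2, ℤ)), Gamma N⁆ := by
  classical
  haveI : NeZero N := ⟨hN0⟩
  let K' : Subgroup (Gamma N) := (⁅(⊤ : Subgroup SL(2, ℤ)), Gamma N⁆).subgroupOf (Gamma N)
  obtain ⟨B, hinv0, hθ₀⟩ := exists_universal_invariant_hom N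
  let θ₀ : Gamma N →* Abelianization (Gamma N) ⧸ B := (QuotientGroup.mk' B).comp Abelianization.of
  have hsurj : Function.Surjective θ₀ :=
    (QuotientGroup.mk'_surjective B).comp QuotientGroup.mk_surjective
  haveI := finiteIndex_commutator_top_Gamma N
  have hK'fin : K'.index ≠ 0 := by
    intro h0
    have h := Subgroup.relIndex_mul_index
      (show ⁅(⊤ : Subgroup SL(2, ℤ)), Gamma N⁆ ≤ Gamma N from
        Subgroup.commutator_le_right _ _ (h := Gamma_normal N))
    rw [Subgroup.relIndex, show (⁅(⊤ : Subgroup SL(2, ℤ)), Gamma N⁆.subgroupOf (Gamma N)).index = 0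
      from h0, zero_mul] at h
    exact Subgroup.FiniteIndex.index_ne_zero h.symm
  have hker : θ₀.ker = K' := by
    ext x
    rw [MonoidHom.mem_ker, hθ₀, Subgroup.mem_subgroupOf]
  haveI : Finite (Abelianization (Gamma N) ⧸ B) := by
    have hcard : Nat.card (Abelianization (Gamma N) ⧸ B) = K'.index := by
      rw [← hker, Subgroup.index_ker, MonoidHom.range_eq_top.mpr hsurj, Subgroup.card_top]
    exact Nat.finite_of_card_ne_zero (hcard ▸ hK'fin)
  intro x hx12
  have hx : x ∈ Gamma N := Gamma_le_Gamma_of_dvd₈ (dvd_mul_left N 12) hx12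
  exact (hθ₀ ⟨x, hx⟩).mp (cor453_invariant_form_cubefree hN0 hcf h4 _ θ₀ hinv0 x hx hx12)

/-- **Subgroup form at one odd prime**: for odd `ℓ` with `ℓ³ ∤ N` there is `k` prime to `ℓ` with
`x^k ∈ [SL₂(ℤ), Γ(N)]` for all `x ∈ Γ(12N)`. [cite: Beyl1986, Theorem] [cite: CalegariDimitrovTang2025, Corollary 4.5.3] -/
theorem exists_pow_mem_commutator_of_cube_not_dvd {ℓ N : ℕ} (hℓ : ℓ.Prime) (hℓ2 : ℓ ≠ 2) (hN0 : N ≠ 0)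
    (hℓN : ¬ ℓ ^ 3 ∣ N) :
    ∃ k : ℕ, ¬ ℓ ∣ k ∧ ∀ x : SL(2, ℤ), x ∈ Gamma (12 * N) → x ^ k ∈ ⁅(⊤ : Subgroup SL(2, ℤ)), Gamma N⁆ := by
  classical
  haveI : NeZero N := ⟨hN0⟩
  let K' : Subgroup (Gamma N) := (⁅(⊤ : Subgroup SL(2, ℤ)), Gamma N⁆).subgroupOf (Gamma N)
  obtain ⟨B, hinv0, hθ₀⟩ := exists_universal_invariant_hom N
  let θ₀ : Gamma N →* Abelianization (Gamma N) ⧸ B := (QuotientGroup.mk' B).comp Abelianization.of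
  have hsurj : Function.Surjective θ₀ :=
    (QuotientGroup.mk'_surjective B).comp QuotientGroup.mk_surjective
  haveI := finiteIndex_commutator_top_Gamma N
  have hK'fin : K'.index ≠ 0 := by
    intro h0
    have h := Subgroup.relIndex_mul_index
      (show ⁅(⊤ : Subgroup SL(2, ℤ)), Gamma N⁆ ≤ Gamma N from
        Subgroup.commutator_le_right _ _ (h := Gamma_normal N))
    rw [Subgroup.relIndex, show (⁅(⊤ : Subgroup SL(2, ℤ)), Gamma N⁆.subgroupOf (Gamma N)).index = 0
      from h0, zero_mul] at h
    exact Subgroup.FiniteIndex.index_ne_zero h.symm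
  have hker : θ₀.ker = K' := by
    ext x
    rw [MonoidHom.mem_ker, hθ₀, Subgroup.mem_subgroupOf]
  haveI : Finite (Abelianization (Gamma N) ⧸ B) := by
    have hcard : Nat.card (Abelianization (Gamma N) ⧸ B) = K'.index := by
      rw [← hker, Subgroup.index_ker, MonoidHom.range_eq_top.mpr hsurj, Subgroup.card_top]
    exact Nat.finite_of_card_ne_zero (hcard ▸ hK'fin)
  refine ⟨ordCompl[ℓ] (Nat.card (Abelianization (Gamma N) ⧸ B)),
    Nat.not_dvd_ordCompl hℓ Nat.card_pos.ne', fun x hx12 ↦ ?_⟩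
  have hx : x ∈ Gamma N := Gamma_le_Gamma_of_dvd₈ (dvd_mul_left N 12) hx12
  have h1 := pow_ordCompl_eq_one_of_cube_not_dvd hℓ hℓ2 hN0 hℓN _ θ₀ hinv0 x hx hx12
  rw [← map_pow] at h1
  have h2 := (hθ₀ _).mp h1
  rwa [Subgroup.coe_pow] at h2

end HcorPrimeSquare

end Summit.BirchSwinnertonDyer.BirchSwinnertonDyer.Theorems
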